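import Summits.AnomalousDissipation.AnomalousDissipation.Theorems.SolenoidalFractalHomogenisationLagrangianStepLedgerTransfer
import Summits.AnomalousDissipation.AnomalousDissipation.Theorems.SolenoidalFractalHomogenisationLagrangianStepOneLevelSplitDefs
import HarnessLib

/-!
# K1L_D (stmt-AnomalousDissipation-27980), S23‴ `stub_windowDefectH`: the transfer ledger ALONG THE REFRESH GRID
# (helper; `--supports … --as helper`; lead-k1l-onelevel-p1 g3)

Instantiation of `transfer_ledger` (…LedgerTransfer) on the long-last-window grid of an observation time `t ∈ [2r, 1]` for window length `r`:
windows `[k r, (k+1) r]` for `k + 2 ≤ K₀ := ⌊t/r⌋₊` and the merged last window `[(K₀−1) r, t]` (length in `[r, 2r)`), all starting at grid points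
`j·r`.  Inputs: two two-parameter families `Um`, `Um1` of contractions of `V2 = L²(𝕋³; ℝ³)` with the cocycle property on `[0,1]` and fixing the start
vector `x` at time `0` (the coarse / true propagators of the S23‴ text), an orthogonal three-way splitting `P, Q₁, Q₂` with `Q₂ x = 0`, and the
PER-WINDOW OPERATOR FACTS (Z) (Hi) (Rec) (see …LedgerTransfer) for every grid-aligned window `[j r, s']`, `j r + r ≤ s' ≤ j r + 2 r`, `s' ≤ t`, on the
true chain state `Um1 0 (j r) x`.  CONCLUSION: `‖Um1 0 t x‖² ≤ ‖Um 0 t x‖² + 1800 ηm (‖x‖² − ‖Um 0 t x‖²) + 5000 (t/r + 1) ε ‖x‖²`.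
Pure Hilbert-space bookkeeping (window indexing, cut-off beyond the last window).  Infrastructure for rung F-D1.A0; NOT a proof of the crux or of AD.
-/

set_option linter.dupNamespace false

namespace Summit.AnomalousDissipation.AnomalousDissipation.Theorems.SolenoidalFractalHomogenisation.LagrangianStep

open scoped InnerProductSpace
open ContinuousLinearMap

noncomputable section

set_option maxHeartbeats 400000 in
/-- **Transfer ledger along the grid.**  See the module docstring. -/
theorem grid_transfer (Um Um1 : ℝ → ℝ → (V2 →L[ℝ] V2)) (P Q₁ Q₂ : V2 →L[ℝ] V2) (x : V2) {r t ηm ε : ℝ}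
    (hr : 0 < r) (hrt : 2 * r ≤ t) (ht1 : t ≤ 1)
    (hUm_le : ∀ s s' y, ‖Um s s' y‖ ≤ ‖y‖) (hUm1_le : ∀ s s' y, ‖Um1 s s' y‖ ≤ ‖y‖)
    (hUm_comp : ∀ s s' s'' y, 0 ≤ s → s ≤ s' → s' ≤ s'' → s'' ≤ 1 → Um s' s'' (Um s s' y) = Um s s'' y)
    (hUm1_comp : ∀ s s' s'' y, 0 ≤ s → s ≤ s' → s' ≤ s'' → s'' ≤ 1 → Um1 s' s'' (Um1 s s' y) = Um1 s s'' y)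
    (hUm0 : Um 0 0 x = x) (hUm10 : Um1 0 0 x = x)
    (hPQ : ∀ y, P y + Q₁ y + Q₂ y = y) (hpyth : ∀ y, ‖y‖ ^ 2 = ‖P y‖ ^ 2 + ‖Q₁ y‖ ^ 2 + ‖Q₂ y‖ ^ 2)
    (horth : ∀ y y', ⟪P y, Q₁ y' + Q₂ y'⟫_ℝ = 0) (hQx : Q₂ x = 0)
    (hηm0 : 0 ≤ ηm) (hηm : ηm ≤ 1 / 3600) (hε0 : 0 ≤ ε) (hε1 : ε ≤ 1)
    (hwin : ∀ (j : ℕ) (s' : ℝ), (j : ℝ) * r + r ≤ s' → s' ≤ (j : ℝ) * r + 2 * r → s' ≤ t →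
          (∀ y : V2, |⟪y, P (Um1 ((j : ℝ) * r) s' (Um1 0 ((j : ℝ) * r) x) - Um ((j : ℝ) * r) s' (Um1 0 ((j : ℝ) * r) x))⟫_ℝ| ≤
              ηm * Real.sqrt (‖Um1 0 ((j : ℝ) * r) x‖ ^ 2 - ‖Um ((j : ℝ) * r) s' (Um1 0 ((j : ℝ) * r) x)‖ ^ 2) * Real.sqrt (‖y‖ ^ 2 - ‖adjoint (Um ((j : ℝ) * r) s') y‖ ^ 2) + ε * ‖x‖ * ‖y‖) ∧
          (∀ y : V2, ‖Um ((j : ℝ) * r) s' (Q₁ y + Q₂ y)‖ ≤ ε * ‖y‖ ∧ ‖Q₁ (Um ((j : ℝ) * r) s' y) + Q₂ (Um ((j : ℝ) * r) s' y)‖ ≤ ε * ‖y‖ ∧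
              ‖adjoint (Um ((j : ℝ) * r) s') (Q₁ y + Q₂ y)‖ ≤ ε * ‖y‖) ∧
          ‖Q₁ (Um1 ((j : ℝ) * r) s' (P (Um1 0 ((j : ℝ) * r) x)))‖ ≤ Real.sqrt (ηm * (‖Um1 0 ((j : ℝ) * r) x‖ ^ 2 - ‖Um ((j : ℝ) * r) s' (Um1 0 ((j : ℝ) * r) x)‖ ^ 2)) + ε * ‖x‖ ∧
          ‖Q₂ (Um1 ((j : ℝ) * r) s' (P (Um1 0 ((j : ℝ) * r) x)))‖ ≤ Real.sqrt (ηm * (‖Um1 0 ((j : ℝ) * r) x‖ ^ 2 - ‖Um ((j : ℝ) * r) s' (Um1 0 ((j : ℝ) * r) x)‖ ^ 2)) + ε * ‖x‖ ∧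
          ‖Q₁ (Um1 ((j : ℝ) * r) s' (Q₁ (Um1 0 ((j : ℝ) * r) x)))‖ ≤ ηm * ‖Q₁ (Um1 0 ((j : ℝ) * r) x)‖ + ε * ‖x‖ ∧
          ‖Q₂ (Um1 ((j : ℝ) * r) s' (Q₁ (Um1 0 ((j : ℝ) * r) x)))‖ ≤ ηm * ‖Q₁ (Um1 0 ((j : ℝ) * r) x)‖ + ε * ‖x‖ ∧
          ‖Q₁ (Um1 ((j : ℝ) * r) s' (Q₂ (Um1 0 ((j : ℝ) * r) x)))‖ ≤ ηm * ‖Q₂ (Um1 0 ((j : ℝ) * r) x)‖ + ε * ‖x‖ ∧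
          ‖Q₂ (Um1 ((j : ℝ) * r) s' (Q₂ (Um1 0 ((j : ℝ) * r) x)))‖ ≤ 1 / 2 * ‖Q₂ (Um1 0 ((j : ℝ) * r) x)‖ + ε * ‖x‖) :
    ‖Um1 0 t x‖ ^ 2 ≤ ‖Um 0 t x‖ ^ 2 + 1800 * ηm * (‖x‖ ^ 2 - ‖Um 0 t x‖ ^ 2) + 5000 * (t / r + 1) * ε * ‖x‖ ^ 2 := by
  -- the grid: `K₀ = ⌊t/r⌋₊ ≥ 2` windows, `w k = k r` for `k < K₀`, `w k = t` from `K₀` on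
  set K₀ : ℕ := ⌊t / r⌋₊ with hK₀_def
  have htr : 2 ≤ t / r := by rw [le_div_iff₀ hr]; linarith
  have hK₀2 : 2 ≤ K₀ := by
    rw [hK₀_def]; exact_mod_cast (Nat.le_floor (by exact_mod_cast htr) : 2 ≤ ⌊t / r⌋₊)
  have hK₀le : (K₀ : ℝ) * r ≤ t := by
    have h := Nat.floor_le (by positivity : 0 ≤ t / r)
    rw [← hK₀_def] at h
    rwa [le_div_iff₀ hr] at h
  have hK₀lt : t < ((K₀ : ℝ) + 1) * r := by
    have h := Nat.lt_floor_add_one (t / r)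
    rw [← hK₀_def] at h
    rw [div_lt_iff₀ hr] at h; linarith
  have ht0 : 0 ≤ t := by linarith
  set w : ℕ → ℝ := fun k => if k < K₀ then (k : ℝ) * r else t with hw_def
  have hw_lt : ∀ k, k < K₀ → w k = (k : ℝ) * r := fun k hk => by simp only [hw_def, hk, if_true]
  have hw_ge : ∀ k, K₀ ≤ k → w k = t := fun k hk => by simp only [hw_def, not_lt.2 hk, if_false]
  have hw0 : w 0 = 0 := by rw [hw_lt 0 (by omega)]; simp
  have hwK : w K₀ = t := hw_ge K₀ le_rfl
  have hw_nonneg : ∀ k, 0 ≤ w k := fun k => by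
    by_cases hk : k < K₀
    · rw [hw_lt k hk]; positivity
    · rw [hw_ge k (not_lt.1 hk)]; exact ht0
  have hw_le_t : ∀ k, w k ≤ t := fun k => by
    by_cases hk : k < K₀
    · rw [hw_lt k hk]
      calc (k : ℝ) * r ≤ (K₀ : ℝ) * r := by have : (k : ℝ) ≤ K₀ := by exact_mod_cast hk.le
                                            exact mul_le_mul_of_nonneg_right this hr.le
        _ ≤ t := hK₀le
    · rw [hw_ge k (not_lt.1 hk)]
  -- window `k < K₀`: `[k r, w (k+1)]` with `k r + r ≤ w (k+1) ≤ k r + 2 r`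
  have hwin_lo : ∀ k, k < K₀ → (k : ℝ) * r + r ≤ w (k + 1) := fun k hk => by
    by_cases hk1 : k + 1 < K₀
    · rw [hw_lt _ hk1]; push_cast; linarith
    · have hkK : k + 1 = K₀ := by omega
      rw [hw_ge _ (by omega)]
      have : ((k : ℝ) + 1) * r ≤ t := by
        have e : ((k : ℝ) + 1) = (K₀ : ℝ) := by exact_mod_cast hkK
        rw [e]; exact hK₀le
      linarith
  have hwin_hi : ∀ k, k < K₀ → w (k + 1) ≤ (k : ℝ) * r + 2 * r := fun k hk => by
    by_cases hk1 : k + 1 < K₀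
    · rw [hw_lt _ hk1]; push_cast; linarith
    · have hkK : k + 1 = K₀ := by omega
      rw [hw_ge _ (by omega)]
      have e : ((k : ℝ) + 1) = (K₀ : ℝ) := by exact_mod_cast hkK
      have : t < ((k : ℝ) + 1 + 1) * r := by rw [e]; exact hK₀lt
      linarith
  have hw_mono : ∀ k, w k ≤ w (k + 1) := fun k => by
    by_cases hk : k < K₀
    · rw [hw_lt k hk]; linarith [hwin_lo k hk, hr.le]
    · rw [hw_ge k (not_lt.1 hk), hw_ge (k + 1) (by omega)]
  -- the window maps and the chains, cut off beyond `K₀`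
  set T : ℕ → V2 →L[ℝ] V2 := fun k => if k < K₀ then Um (w k) (w (k + 1)) else 0 with hT_def
  set U : ℕ → V2 →L[ℝ] V2 := fun k => if k < K₀ then Um1 (w k) (w (k + 1)) else 0 with hU_def
  set u : ℕ → V2 := fun k => if k ≤ K₀ then Um1 0 (w k) x else 0 with hu_def
  set v : ℕ → V2 := fun k => if k ≤ K₀ then Um 0 (w k) x else 0 with hv_def
  have hT_lt : ∀ k, k < K₀ → T k = Um (w k) (w (k + 1)) := fun k hk => by simp only [hT_def, hk, if_true]
  have hT_ge : ∀ k, K₀ ≤ k → T k = 0 := fun k hk => by simp only [hT_def, not_lt.2 hk, if_false]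
  have hU_lt : ∀ k, k < K₀ → U k = Um1 (w k) (w (k + 1)) := fun k hk => by simp only [hU_def, hk, if_true]
  have hU_ge : ∀ k, K₀ ≤ k → U k = 0 := fun k hk => by simp only [hU_def, not_lt.2 hk, if_false]
  have hu_le : ∀ k, k ≤ K₀ → u k = Um1 0 (w k) x := fun k hk => by simp only [hu_def, hk, if_true]
  have hu_gt : ∀ k, K₀ < k → u k = 0 := fun k hk => by simp only [hu_def, not_le.2 hk, if_false]
  have hv_le : ∀ k, k ≤ K₀ → v k = Um 0 (w k) x := fun k hk => by simp only [hv_def, hk, if_true]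
  have hv_gt : ∀ k, K₀ < k → v k = 0 := fun k hk => by simp only [hv_def, not_le.2 hk, if_false]
  have hT : ∀ k y, ‖T k y‖ ≤ ‖y‖ := fun k y => by
    by_cases hk : k < K₀
    · rw [hT_lt k hk]; exact hUm_le _ _ _
    · rw [hT_ge k (not_lt.1 hk)]; simp
  have hU : ∀ k y, ‖U k y‖ ≤ ‖y‖ := fun k y => by
    by_cases hk : k < K₀
    · rw [hU_lt k hk]; exact hUm1_le _ _ _
    · rw [hU_ge k (not_lt.1 hk)]; simp
  have hu0 : u 0 = x := by rw [hu_le 0 (by omega), hw0, hUm10]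
  have hv0 : v 0 = x := by rw [hv_le 0 (by omega), hw0, hUm0]
  have hus : ∀ k, u (k + 1) = U k (u k) := fun k => by
    by_cases hk : k < K₀
    · rw [hu_le (k + 1) (by omega), hU_lt k hk, hu_le k hk.le,
        hUm1_comp 0 (w k) (w (k + 1)) x le_rfl (hw_nonneg k) (hw_mono k) ((hw_le_t _).trans ht1)]
    · rw [hu_gt (k + 1) (by omega), hU_ge k (not_lt.1 hk)]; simp
  have hvs : ∀ k, v (k + 1) = T k (v k) := fun k => by
    by_cases hk : k < K₀
    · rw [hv_le (k + 1) (by omega), hT_lt k hk, hv_le k hk.le,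
        hUm_comp 0 (w k) (w (k + 1)) x le_rfl (hw_nonneg k) (hw_mono k) ((hw_le_t _).trans ht1)]
    · rw [hv_gt (k + 1) (by omega), hT_ge k (not_lt.1 hk)]; simp
  -- the facts, window by window (trivial beyond `K₀`)
  have hx0 : 0 ≤ ‖x‖ := norm_nonneg _
  have hF : ∀ k, k < K₀ →
      (∀ y : V2, |⟪y, P (Um1 (w k) (w (k + 1)) (Um1 0 (w k) x) - Um (w k) (w (k + 1)) (Um1 0 (w k) x))⟫_ℝ| ≤
          ηm * Real.sqrt (‖Um1 0 (w k) x‖ ^ 2 - ‖Um (w k) (w (k + 1)) (Um1 0 (w k) x)‖ ^ 2) * Real.sqrt (‖y‖ ^ 2 - ‖adjoint (Um (w k) (w (k + 1))) y‖ ^ 2) + ε * ‖x‖ * ‖y‖) ∧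
      (∀ y : V2, ‖Um (w k) (w (k + 1)) (Q₁ y + Q₂ y)‖ ≤ ε * ‖y‖ ∧ ‖Q₁ (Um (w k) (w (k + 1)) y) + Q₂ (Um (w k) (w (k + 1)) y)‖ ≤ ε * ‖y‖ ∧
          ‖adjoint (Um (w k) (w (k + 1))) (Q₁ y + Q₂ y)‖ ≤ ε * ‖y‖) ∧
      ‖Q₁ (Um1 (w k) (w (k + 1)) (P (Um1 0 (w k) x)))‖ ≤ Real.sqrt (ηm * (‖Um1 0 (w k) x‖ ^ 2 - ‖Um (w k) (w (k + 1)) (Um1 0 (w k) x)‖ ^ 2)) + ε * ‖x‖ ∧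
      ‖Q₂ (Um1 (w k) (w (k + 1)) (P (Um1 0 (w k) x)))‖ ≤ Real.sqrt (ηm * (‖Um1 0 (w k) x‖ ^ 2 - ‖Um (w k) (w (k + 1)) (Um1 0 (w k) x)‖ ^ 2)) + ε * ‖x‖ ∧
      ‖Q₁ (Um1 (w k) (w (k + 1)) (Q₁ (Um1 0 (w k) x)))‖ ≤ ηm * ‖Q₁ (Um1 0 (w k) x)‖ + ε * ‖x‖ ∧
      ‖Q₂ (Um1 (w k) (w (k + 1)) (Q₁ (Um1 0 (w k) x)))‖ ≤ ηm * ‖Q₁ (Um1 0 (w k) x)‖ + ε * ‖x‖ ∧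
      ‖Q₁ (Um1 (w k) (w (k + 1)) (Q₂ (Um1 0 (w k) x)))‖ ≤ ηm * ‖Q₂ (Um1 0 (w k) x)‖ + ε * ‖x‖ ∧
      ‖Q₂ (Um1 (w k) (w (k + 1)) (Q₂ (Um1 0 (w k) x)))‖ ≤ 1 / 2 * ‖Q₂ (Um1 0 (w k) x)‖ + ε * ‖x‖ := by
    intro k hk
    have h := hwin k (w (k + 1)) (hwin_lo k hk) (hwin_hi k hk) (hw_le_t _)
    rw [← hw_lt k hk] at h
    exact h
  have key := transfer_ledger T U P Q₁ Q₂ x u v ηm ε hT hU hPQ hpyth horth hQx hηm0 hηm hε0 hε1 hu0 hus hv0 hvs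
    ?_ ?_ ?_ ?_ ?_ ?_ ?_ ?_ K₀
  · -- read off the conclusion at `K₀`
    have huK : u K₀ = Um1 0 t x := by rw [hu_le K₀ le_rfl, hwK]
    have hvK : v K₀ = Um 0 t x := by rw [hv_le K₀ le_rfl, hwK]
    rw [huK, hvK] at key
    have hK₀r : (K₀ : ℝ) ≤ t / r := by rw [le_div_iff₀ hr]; exact hK₀le
    have hx2 : 0 ≤ ε * ‖x‖ ^ 2 := by positivity
    have : 5000 * ((K₀ : ℝ) + 1) * ε * ‖x‖ ^ 2 ≤ 5000 * (t / r + 1) * ε * ‖x‖ ^ 2 := by nlinarith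
    linarith
  -- (Z)
  · intro k y
    by_cases hk : k < K₀
    · rw [hT_lt k hk, hU_lt k hk, hu_le k hk.le]; exact (hF k hk).1 y
    · rw [hT_ge k (not_lt.1 hk), hU_ge k (not_lt.1 hk)]
      simp only [zero_apply, sub_zero, map_zero, inner_zero_right, abs_zero]
      positivity
  -- (Hi)
  · intro k y
    by_cases hk : k < K₀
    · rw [hT_lt k hk]; exact (hF k hk).2.1 y
    · rw [hT_ge k (not_lt.1 hk)]
      have h0 : adjoint (0 : V2 →L[ℝ] V2) = 0 := map_zero _
      rw [h0]
      simp only [zero_apply, map_zero, add_zero, norm_zero]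
      exact ⟨by positivity, by positivity, by positivity⟩
  -- (R1)–(R6)
  · intro k
    by_cases hk : k < K₀
    · rw [hT_lt k hk, hU_lt k hk, hu_le k hk.le]; exact (hF k hk).2.2.1
    · rw [hU_ge k (not_lt.1 hk)]; simp only [zero_apply, map_zero, norm_zero]; positivity
  · intro k
    by_cases hk : k < K₀
    · rw [hT_lt k hk, hU_lt k hk, hu_le k hk.le]; exact (hF k hk).2.2.2.1
    · rw [hU_ge k (not_lt.1 hk)]; simp only [zero_apply, map_zero, norm_zero]; positivity
  · intro k
    by_cases hk : k < K₀
    · rw [hU_lt k hk, hu_le k hk.le]; exact (hF k hk).2.2.2.2.1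
    · rw [hU_ge k (not_lt.1 hk)]; simp only [zero_apply, map_zero, norm_zero]; positivity
  · intro k
    by_cases hk : k < K₀
    · rw [hU_lt k hk, hu_le k hk.le]; exact (hF k hk).2.2.2.2.2.1
    · rw [hU_ge k (not_lt.1 hk)]; simp only [zero_apply, map_zero, norm_zero]; positivity
  · intro k
    by_cases hk : k < K₀
    · rw [hU_lt k hk, hu_le k hk.le]; exact (hF k hk).2.2.2.2.2.2.1
    · rw [hU_ge k (not_lt.1 hk)]; simp only [zero_apply, map_zero, norm_zero]; positivity
  · intro k
    by_cases hk : k < K₀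
    · rw [hU_lt k hk, hu_le k hk.le]; exact (hF k hk).2.2.2.2.2.2.2
    · rw [hU_ge k (not_lt.1 hk)]; simp only [zero_apply, map_zero, norm_zero]; positivity

end

end Summit.AnomalousDissipation.AnomalousDissipation.Theorems.SolenoidalFractalHomogenisation.LagrangianStep
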